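import Summits.QuantumFields.YangMills.Theorems.SmallFieldWideningLargeFieldMassRefinementTailPerFamilyUnitTop
import Summits.QuantumFields.YangMills.Theorems.SmallFieldWideningLargeFieldMassRefinementTailLowHeights

/-!
# Route `SmallFieldWidening`, crux r3 `LargeFieldMassRefinementTail` (stmt-QuantumFields-22884), line `birth` v6 — r3 FROM A ONE-STEP
# CONDITIONAL UV-STABILITY OF THE UNIT TAIL IN THE PURE SMALL-FIELD SECTOR («adding one ultraviolet level does not raise the conditional
# probability of a large unit plaquette given a small sub-unit history by more than `e^{ρ_K}`, `Σ_K ρ_K` finite family by family»)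
# (support file; width seat `ym-line-sfw-p2-w2` gen 17; the stub `stub_firstExitDeep`, the crux and rung R3 stay OPEN)

WHAT THIS IS NOT.  No estimate of Bałaban's programme is proved; nothing bears on the Yang–Mills mass gap; rung R3 (`YM3TorusSU2`) is a RECORD rung.
This file reduces crux r3 to a ONE-RENORMALISATION-STEP statement and records the reduction as a kernel theorem.

THE STATEMENT `CondStab` (hypothesis of ★ `largeFieldMassRefinementTail_of_condStabFam`; per family `F`, coupling `γ > 0`, profile `(b₀, p₀)`
chosen once per block size).  For the refined family `F_d := F.refine d` at `γ_d := γL^{-d}` and its run `K`, let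
`S^d_K := histGood F_d θ_{γ_d} K 1` (every block field STRICTLY BELOW the unit lattice is small at its height — the pure small-field sector)
and, for a unit plaquette label `q`, `E^d_{K,q} := {θ_{γ_d}(0) ≤ |Ū^K(∂q) − 1|}`; write `c^d_K(q) := Gibbs^{F_d}_K[ E^d_{K,q} | S^d_K ]`
(Mathlib `ProbabilityTheory.cond`).  `CondStab` asks: there are `n₁` and `R : ℕ → ℝ` with `R d = A_η + η·p_{b₀}(√γ_d)²` for EVERY `η > 0`
(sub-Gaussian accumulated slack; e.g. `R` bounded) such that for every depth `d ≥ n₁` and label `q` there are one-step slacks `ρ_K` with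
`Σ_{2 ≤ k < K} ρ_k ≤ R d` and
                         `c^d_{K+1}(q) ≤ exp(ρ_K) · c^d_K(q)`     for every `K ≥ 2`
— one more ultraviolet level (run `K+1` versus run `K` of the SAME family at the SAME unit coupling) does not raise the conditional unit tail
in the small-field sector by more than `e^{ρ_K}`.  In the lattice-Maxwell caricature the unit-plaquette variance of the `K`-fold (0.4)-average
is DECREASING in `K` (kit j291705, `bc/gauss_kuniform.md` of cell ym-idea-1: `0.2541, 0.2153, 0.2110, 0.2105` for `K = 1..4`, `L = 3`), so there
`ρ ≡ 0`; the interacting corrections at depth `d` are `O(g_d²)`-small.  This is the small-field half of ONE step of [Balaban1985UV3]/[Balaban1987RG1],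
read on one local tail event; the whole large-field machinery and every statement uniform in the height are absent.

THE REDUCTION (§3).  Chain the one-step bounds down to the two-step run: `c^d_K(q) ≤ e^{R d}·c^d_2(q)` (§1 `chain_le`); the mass of the unit-top
event is `≤` its conditional probability (§1 `real_inter_le_cond_real`, the history has mass `≤ 1`); at `K = 2`, `c^d_2 ≤ 2·Gibbs(S ∩ E)` once
`Gibbs(S^d_2) ≥ ½`, which holds for deep `d` UNCONDITIONALLY (the landed `…LowHeights.refinedMass_null_lowHeights` with `J₀ = 1`); and the
two-step unit-top mass is `≤ C_b·β_d^{A}·e^{−c_b p(g_d)²}` UNCONDITIONALLY (the landed bounded-height tail `HistoryTailBoundedHeight.unitScaleTilt_perPlaquette_boundedHeight`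
with `j₀ = 2`, read on the refinements through the companion transport `…UnitTop.gibbsK_real_firstExit_eq_refine`).  With `η = c_b/2` the slack is
absorbed: the unit-top tails of the deep refinements are `≤ 2C_b e^{A}·β_d^{A}·e^{−(c_b/2)p(g_d)²}`, which is the hypothesis of the landed
`…PerFamilyUnitTop.largeFieldMassRefinementTail_of_unitTopFam`.  Hence ★ r3.  Because the chain only TRANSPORTS the crude two-step bound upward in
`K` with multiplicative slack, the weakness of the crude Gaussian constant `c_b = ¼(151L²)^{−4}` is harmless.

References: T. Bałaban, Commun. Math. Phys. **102** (1985) 255–275 [Balaban1985UV3] ((1)–(3) p.256, (7) p.257, (70)–(71) p.273); CMP **109** (1987)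
249–301 [Balaban1987RG1] (Thm 1 p.259, (0.4)/(0.11) p.253); CMP **98** (1985) 17–51 [Balaban1985Averaging] (Prop. 1 (51) p.26).
-/

noncomputable section

open MeasureTheory Filter Topology ProbabilityTheory
open scoped BigOperators
open Literature.MathematicalPhysics.QuantumFieldTheory.Balaban1983to89
open Literature.MathematicalPhysics.QuantumFieldTheory.Balaban1983to89.Missing
open Literature.MathematicalPhysics.QuantumFieldTheory.Balaban1983to89.T3ContinuumYM3Torus
open Literature.MathematicalPhysics.QuantumFieldTheory.Balaban1983to89.T3UnitScaleTilt
open Literature.MathematicalPhysics.QuantumFieldTheory.Balaban1983to89.T3UnitLawDensityEML (ℰp measurableE_ℰp)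
open Literature.MathematicalPhysics.QuantumFieldTheory.Balaban1983to89.T3LevelShift
open Summit.QuantumFields.YangMills.Theorems.LargeFieldMassRefinementTailOfHeightTail (refine_refine)
open Summit.QuantumFields.YangMills.Theorems.LargeFieldMassRefinementTailFreeTopSteps (eventually_coupling_le)
open Summit.QuantumFields.YangMills.Theorems.LargeFieldMassRefinementTailLowHeights (refinedMass_null_lowHeights)
open Summit.QuantumFields.YangMills.Theorems.HistoryTailBoundedHeight (unitScaleTilt_perPlaquette_boundedHeight)
open Summit.QuantumFields.YangMills.Theorems.LargeFieldMassRefinementTailUnitTop (gibbsK_real_firstExit_eq_refine)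
open Summit.QuantumFields.YangMills.Theorems.LargeFieldMassRefinementTailPerFamilyUnitTop (largeFieldMassRefinementTail_of_unitTopFam)

namespace Summit.QuantumFields.YangMills.Theorems.LargeFieldMassRefinementTailCondStab

/-! ## §1 Two elementary lemmas: chaining one-step slacks; a joint mass is at most the conditional probability -/

section Elementary

/-- **CHAINING**: `c_{K+1} ≤ e^{ρ_K} c_K` for `K ≥ 2` gives `c_K ≤ exp(Σ_{2≤k<K} ρ_k)·c_2`. [folklore] -/
theorem chain_le {c ρ : ℕ → ℝ} (h : ∀ K, 2 ≤ K → c (K + 1) ≤ Real.exp (ρ K) * c K) :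
    ∀ K, 2 ≤ K → c K ≤ Real.exp (∑ k ∈ Finset.Ico 2 K, ρ k) * c 2 := by
  intro K hK
  induction K, hK using Nat.le_induction with
  | base => simp
  | succ K hK ih =>
    calc c (K + 1) ≤ Real.exp (ρ K) * c K := h K hK
      _ ≤ Real.exp (ρ K) * (Real.exp (∑ k ∈ Finset.Ico 2 K, ρ k) * c 2) :=
          mul_le_mul_of_nonneg_left ih (Real.exp_nonneg _)
      _ = Real.exp (∑ k ∈ Finset.Ico 2 (K + 1), ρ k) * c 2 := by
          rw [Finset.sum_Ico_succ_top hK, Real.exp_add]; ring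

variable {X : Type*} [MeasurableSpace X]

/-- **JOINT MASS ≤ CONDITIONAL PROBABILITY** for a probability measure: `μ(S ∩ E) ≤ μ[E | S]` (the condition has mass `≤ 1`; if it is null both
sides vanish). [folklore] -/
theorem real_inter_le_cond_real (μ : Measure X) [IsProbabilityMeasure μ] {S : Set X} (hS : MeasurableSet S) (E : Set X) :
    μ.real (S ∩ E) ≤ (cond μ S).real E := by
  by_cases h0 : μ S = 0
  · have : μ (S ∩ E) = 0 := measure_mono_null Set.inter_subset_left h0
    rw [measureReal_def, this, ENNReal.toReal_zero]
    exact measureReal_nonneg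
  · haveI := cond_isProbabilityMeasure (μ := μ) h0
    rw [measureReal_def, measureReal_def, cond_apply hS μ E]
    refine ENNReal.toReal_mono (ENNReal.mul_ne_top (ENNReal.inv_ne_top.mpr h0) (measure_ne_top _ _)) ?_
    calc μ (S ∩ E) = 1 * μ (S ∩ E) := (one_mul _).symm
      _ ≤ (μ S)⁻¹ * μ (S ∩ E) := by
          gcongr
          exact ENNReal.one_le_inv.mpr prob_le_one

/-- **CONDITIONAL PROBABILITY ≤ TWICE THE JOINT MASS** when the condition has mass `≥ ½`. [folklore] -/
theorem cond_real_le_two_mul (μ : Measure X) [IsProbabilityMeasure μ] {S : Set X} (hS : MeasurableSet S)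
    (hhalf : (1 : ℝ) / 2 ≤ μ.real S) (E : Set X) :
    (cond μ S).real E ≤ 2 * μ.real (S ∩ E) := by
  have hSpos : 0 < μ.real S := lt_of_lt_of_le (by norm_num) hhalf
  have h0 : μ S ≠ 0 := fun h => by rw [measureReal_def, h, ENNReal.toReal_zero] at hSpos; exact lt_irrefl _ hSpos
  rw [measureReal_def, cond_apply hS μ E, ENNReal.toReal_mul, ENNReal.toReal_inv, ← measureReal_def, ← measureReal_def]
  rw [inv_mul_le_iff₀ hSpos]
  nlinarith [measureReal_nonneg (μ := μ) (s := S ∩ E)]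

end Elementary

/-! ## §2 The two-step base, unconditionally, read on the refinements of one family -/

section Base

/-- **THE TWO-STEP UNIT-TOP TAIL OF THE DEEP REFINEMENTS, UNCONDITIONALLY** (per family, per coupling): there are `n₂, A, C_b ≥ 0, c_b > 0` with, for
every depth `d ≥ n₂` and every unit plaquette `p` of the TWO-step run of `F.refine d` at `γL^{-d}`,
`Gibbs{ bare and once-averaged fields small ∧ θ(0) ≤ |Ū²(∂p) − 1| } ≤ C_b·(γL^{-d})^{-A}·exp(−c_b·p_{b₀}(√(γL^{-d}))²)` — the landed bounded-height
tail (`unitScaleTilt_perPlaquette_boundedHeight`, `j₀ = 2`, crude Prop. 1 twice + chessboard) of the ONE family `F.refine n₂` (`γL^{-n₂} ≤ 1`), transported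
to the refinements (`gibbsK_real_firstExit_eq_refine`). [cite: Balaban1985UV3, (7) p.257 and (71) p.273; Balaban1985Averaging, Prop. 1 (51) p.26] -/
theorem exists_base_two (F : T3Family) {γ b₀ : ℝ} (hγ : 0 < γ) (hb₀ : 0 < b₀) (p₀ : ℝ) :
    ∃ (n₂ A : ℕ) (C c : ℝ), 0 ≤ C ∧ 0 < c ∧ ∀ d : ℕ, n₂ ≤ d → ∀ p : Plaq ((F.refine d).P 2) 2,
      (gibbsK (F.refine d) ℰp (γ * ((F.L : ℝ)⁻¹) ^ d) 2).real
          {V | (∀ k, k < 2 → PlaqSmall (θBal F.L (γ * ((F.L : ℝ)⁻¹) ^ d) b₀ p₀ (2 - k))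
              (Averaging.iter (fun i => BlockAveraging.blockAvg (P := (F.refine d).P 2) (j := i) ℰp) k V)) ∧
            θBal F.L (γ * ((F.L : ℝ)⁻¹) ^ d) b₀ p₀ 0 ≤ GaugeGroup.dist1 (GaugeField.plaqHol
              (Averaging.iter (fun i => BlockAveraging.blockAvg (P := (F.refine d).P 2) (j := i) ℰp) 2 V) p)} ≤
        C * ((γ * ((F.L : ℝ)⁻¹) ^ d)⁻¹) ^ A * Real.exp (-(c * B10.pFun b₀ p₀ (Real.sqrt (γ * ((F.L : ℝ)⁻¹) ^ d)) ^ 2)) := by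
  classical
  obtain ⟨n₂, hn₂⟩ := (eventually_coupling_le F γ one_pos).exists_forall_of_atTop
  have hL0 : (0 : ℝ) < F.L := by exact_mod_cast (zero_lt_one.trans F.hL.2)
  set γ' : ℝ := γ * ((F.L : ℝ)⁻¹) ^ n₂ with hγ'def
  have hγ' : 0 < γ' := mul_pos hγ (pow_pos (inv_pos.mpr hL0) _)
  have hγ'1 : γ' ≤ 1 := hn₂ n₂ le_rfl
  set G : T3Family := F.refine n₂ with hGdef
  obtain ⟨C, A, c, hC, hc, hpp⟩ := unitScaleTilt_perPlaquette_boundedHeight 2 G hγ' hγ'1 hb₀.le p₀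
  refine ⟨n₂, A, C, c, hC, hc, fun d hd => ?_⟩
  obtain ⟨e, rfl⟩ := Nat.exists_eq_add_of_le hd
  -- identify `F.refine (n₂ + e)` with `G.refine e` and `γL^{-(n₂+e)}` with `γ'L^{-e}`
  have hcoup : γ * ((F.L : ℝ)⁻¹) ^ (n₂ + e) = γ' * ((G.L : ℝ)⁻¹) ^ e := by
    rw [pow_add, hγ'def, mul_assoc]; rfl
  rw [hcoup]
  generalize hH : F.refine (n₂ + e) = H
  rw [← refine_refine F n₂ e] at hH
  subst hH
  rw [show F.L = G.L from rfl]
  intro p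
  -- `p` is the image of a height-2 plaquette of run `2 + e` of `G`
  set h₀ := G.sitesPerDir_eq (m := G.m) (K := 2 + e) (j := 2) (m' := G.m + e) (K' := 2) (j' := 2) (by omega) with hh₀
  obtain ⟨p', rfl⟩ : ∃ p' : Plaq (G.P (2 + e)) 2, p = plaqShift h₀ p' :=
    ⟨(plaqShift h₀).symm p, ((plaqShift h₀).apply_symm_apply p).symm⟩
  rw [← gibbsK_real_firstExit_eq_refine G γ' hγ'.le b₀ p₀ e 2 p']
  haveI := isProbabilityMeasure_gibbsK G ℰp hγ'.le (2 + e)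
  refine (measureReal_mono (fun U hU => hU.2) (measure_ne_top _ _)).trans ?_
  have key := hpp (2 + e) 2 (by omega) le_rfl p'
  rw [show 2 + e - 2 = e by omega] at key
  exact key

/-- **THE TWO-STEP SMALL SUB-UNIT HISTORY HAS MASS ≥ ½ AT DEEP REFINEMENTS, UNCONDITIONALLY** (per family, per coupling, `0 < b₀`, `1 ≤ p₀`): the
landed `refinedMass_null_lowHeights` with `J₀ = 1` (bare and once-averaged heights of every run, here the run `K = 2`). [cite: Balaban1985UV3, (7) p.257] -/
theorem exists_history_two_ge_half (F : T3Family) {γ b₀ p₀ : ℝ} (hγ : 0 < γ) (hb₀ : 0 < b₀) (hp₀ : 1 ≤ p₀) :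
    ∃ n₃ : ℕ, ∀ d : ℕ, n₃ ≤ d →
      (1 : ℝ) / 2 ≤ (gibbsK (F.refine d) ℰp (γ * ((F.L : ℝ)⁻¹) ^ d) 2).real
        (histGood (F.refine d) ℰp (θBal F.L (γ * ((F.L : ℝ)⁻¹) ^ d) b₀ p₀) 2 1) := by
  obtain ⟨δ, hδ, hδb⟩ := refinedMass_null_lowHeights 1 F hγ hb₀ hp₀
  obtain ⟨n₂, hn₂⟩ := (eventually_coupling_le F γ one_pos).exists_forall_of_atTop
  obtain ⟨n₃, hn₃⟩ := (hδ.eventually (gt_mem_nhds (by norm_num : (0 : ℝ) < 1 / 2))).exists_forall_of_atTop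
  refine ⟨max n₂ n₃, fun d hd => ?_⟩
  have hL0 : (0 : ℝ) < F.L := by exact_mod_cast (zero_lt_one.trans F.hL.2)
  haveI := isProbabilityMeasure_gibbsK (F.refine d) ℰp (mul_nonneg hγ.le (pow_nonneg (inv_nonneg.mpr hL0.le) d)) 2
  have hbad := hδb d 2 (hn₂ d (le_of_max_le_left hd))
  rw [show (2 : ℕ) - 1 = 1 from rfl] at hbad
  simp only [T3Family.refine_L] at hbad
  have hδd := hn₃ d (le_of_max_le_right hd)
  have hcompl := measureReal_compl (μ := gibbsK (F.refine d) ℰp (γ * ((F.L : ℝ)⁻¹) ^ d) 2)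
    (measurableSet_histGood (F.refine d) ℰp measurableE_ℰp (θBal F.L (γ * ((F.L : ℝ)⁻¹) ^ d) b₀ p₀) 2 1)
  rw [probReal_univ] at hcompl
  linarith

end Base

/-! ## §3 Crux r3 from the one-step conditional stability -/

section Reduction

/-- ★ **THE UNIT-TOP TAILS OF THE DEEP REFINEMENTS FROM ONE-STEP CONDITIONAL STABILITY** (one family `F`, one coupling `γ > 0`, a profile with
`0 < b₀`, `1 ≤ p₀`): if `CondStab` holds — accumulated one-step slacks `R d` with `R d ≤ A_η + η·p(g_d)²` for every `η > 0`, and for every deep `d`,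
label `q` and `K ≥ 2`, `Gibbs^{F_d}_{K+1}[E | S] ≤ e^{ρ_K}·Gibbs^{F_d}_K[E | S]` with `Σ_{2≤k<K} ρ_k ≤ R d` — then for some `n₁, N, C, c > 0` every
run `K ≥ 2` of every refinement `F.refine d`, `d ≥ n₁`, has unit-top tail `≤ C·(γL^{-d})^{-N}·exp(−c·p(√(γL^{-d}))²)`.
[cite: Balaban1985UV3, (7) p.257 and (70)-(71) p.273; Balaban1987RG1, Thm 1 p.259] -/
theorem unitTopBody_of_condStab (F : T3Family) {γ b₀ p₀ : ℝ} (hγ : 0 < γ) (hb₀ : 0 < b₀) (hp₀ : 1 ≤ p₀)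
    (hCS : ∃ (n₁ : ℕ) (R : ℕ → ℝ),
      (∀ η : ℝ, 0 < η → ∃ A : ℝ, ∀ d : ℕ, n₁ ≤ d →
        R d ≤ A + η * B10.pFun b₀ p₀ (Real.sqrt (γ * ((F.L : ℝ)⁻¹) ^ d)) ^ 2) ∧
      ∀ d : ℕ, n₁ ≤ d → ∀ q : Plaq ((F.refine d).P 0) 0, ∃ ρ : ℕ → ℝ,
        (∀ K : ℕ, ∑ k ∈ Finset.Ico 2 K, ρ k ≤ R d) ∧
        ∀ K : ℕ, 2 ≤ K →
          (cond (gibbsK (F.refine d) ℰp (γ * ((F.L : ℝ)⁻¹) ^ d) (K + 1))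
              (histGood (F.refine d) ℰp (θBal F.L (γ * ((F.L : ℝ)⁻¹) ^ d) b₀ p₀) (K + 1) 1)).real
            {U | θBal F.L (γ * ((F.L : ℝ)⁻¹) ^ d) b₀ p₀ 0 ≤ GaugeGroup.dist1 (GaugeField.plaqHol
              (Averaging.iter (fun i => BlockAveraging.blockAvg (P := (F.refine d).P (K + 1)) (j := i) ℰp) (K + 1) U)
              (plaqShift ((F.refine d).sitesPerDir_unit (K + 1)) q))} ≤
          Real.exp (ρ K) *
          (cond (gibbsK (F.refine d) ℰp (γ * ((F.L : ℝ)⁻¹) ^ d) K)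
              (histGood (F.refine d) ℰp (θBal F.L (γ * ((F.L : ℝ)⁻¹) ^ d) b₀ p₀) K 1)).real
            {U | θBal F.L (γ * ((F.L : ℝ)⁻¹) ^ d) b₀ p₀ 0 ≤ GaugeGroup.dist1 (GaugeField.plaqHol
              (Averaging.iter (fun i => BlockAveraging.blockAvg (P := (F.refine d).P K) (j := i) ℰp) K U)
              (plaqShift ((F.refine d).sitesPerDir_unit K) q))}) :
    ∃ (n₁ N : ℕ) (C c : ℝ), 0 < c ∧ ∀ d : ℕ, n₁ ≤ d → ∀ K : ℕ, 2 ≤ K → ∀ p : Plaq ((F.refine d).P K) K,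
      (gibbsK (F.refine d) ℰp (γ * ((F.L : ℝ)⁻¹) ^ d) K).real
          {V | (∀ k, k < K → PlaqSmall (θBal F.L (γ * ((F.L : ℝ)⁻¹) ^ d) b₀ p₀ (K - k))
              (Averaging.iter (fun i => BlockAveraging.blockAvg (P := (F.refine d).P K) (j := i) ℰp) k V)) ∧
            θBal F.L (γ * ((F.L : ℝ)⁻¹) ^ d) b₀ p₀ 0 ≤ GaugeGroup.dist1 (GaugeField.plaqHol
              (Averaging.iter (fun i => BlockAveraging.blockAvg (P := (F.refine d).P K) (j := i) ℰp) K V) p)} ≤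
        C * ((γ * ((F.L : ℝ)⁻¹) ^ d)⁻¹) ^ N *
          Real.exp (-(c * B10.pFun b₀ p₀ (Real.sqrt (γ * ((F.L : ℝ)⁻¹) ^ d)) ^ 2)) := by
  classical
  obtain ⟨n₁, R, hgrowth, hstep⟩ := hCS
  obtain ⟨n₂, A_b, C_b, c_b, hC_b, hc_b, hbase⟩ := exists_base_two F hγ hb₀ p₀
  obtain ⟨n₃, hhalf⟩ := exists_history_two_ge_half F hγ hb₀ hp₀
  obtain ⟨A, hA⟩ := hgrowth (c_b / 2) (half_pos hc_b)
  have hL0 : (0 : ℝ) < F.L := by exact_mod_cast (zero_lt_one.trans F.hL.2)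
  refine ⟨max n₁ (max n₂ n₃), A_b, 2 * C_b * Real.exp A, c_b / 2, half_pos hc_b, fun d hd K hK p => ?_⟩
  have hd₁ : n₁ ≤ d := le_of_max_le_left hd
  have hd₂ : n₂ ≤ d := le_of_max_le_left (le_of_max_le_right hd)
  have hd₃ : n₃ ≤ d := le_of_max_le_right (le_of_max_le_right hd)
  have hγd0 : 0 ≤ γ * ((F.L : ℝ)⁻¹) ^ d := mul_nonneg hγ.le (pow_nonneg (inv_nonneg.mpr hL0.le) d)
  -- the unit plaquette label of `p`, the one-step slacks, the chained bound
  obtain ⟨ρ, hρ, hchain⟩ := hstep d hd₁ ((plaqShift ((F.refine d).sitesPerDir_unit K)).symm p)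
  have hch := chain_le (ρ := ρ)
    (c := fun K' => (cond (gibbsK (F.refine d) ℰp (γ * ((F.L : ℝ)⁻¹) ^ d) K')
        (histGood (F.refine d) ℰp (θBal F.L (γ * ((F.L : ℝ)⁻¹) ^ d) b₀ p₀) K' 1)).real
      {U | θBal F.L (γ * ((F.L : ℝ)⁻¹) ^ d) b₀ p₀ 0 ≤ GaugeGroup.dist1 (GaugeField.plaqHol
        (Averaging.iter (fun i => BlockAveraging.blockAvg (P := (F.refine d).P K') (j := i) ℰp) K' U)
        (plaqShift ((F.refine d).sitesPerDir_unit K') ((plaqShift ((F.refine d).sitesPerDir_unit K)).symm p)))})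
    hchain K hK
  beta_reduce at hch
  have hpq : plaqShift ((F.refine d).sitesPerDir_unit K) ((plaqShift ((F.refine d).sitesPerDir_unit K)).symm p) = p :=
    (plaqShift ((F.refine d).sitesPerDir_unit K)).apply_symm_apply p
  rw [hpq] at hch
  -- (1) the unit-top mass at run `K` is at most the conditional tail
  haveI := isProbabilityMeasure_gibbsK (F.refine d) ℰp hγd0 K
  have hS : MeasurableSet (histGood (F.refine d) ℰp (θBal F.L (γ * ((F.L : ℝ)⁻¹) ^ d) b₀ p₀) K 1) :=
    measurableSet_histGood (F.refine d) ℰp measurableE_ℰp _ K 1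
  have hevent : {V : GaugeField ((F.refine d).P K) 0 (Matrix.specialUnitaryGroup (Fin 2) ℂ) |
      (∀ k, k < K → PlaqSmall (θBal F.L (γ * ((F.L : ℝ)⁻¹) ^ d) b₀ p₀ (K - k))
        (Averaging.iter (fun i => BlockAveraging.blockAvg (P := (F.refine d).P K) (j := i) ℰp) k V)) ∧
      θBal F.L (γ * ((F.L : ℝ)⁻¹) ^ d) b₀ p₀ 0 ≤ GaugeGroup.dist1 (GaugeField.plaqHol
        (Averaging.iter (fun i => BlockAveraging.blockAvg (P := (F.refine d).P K) (j := i) ℰp) K V) p)} =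
      histGood (F.refine d) ℰp (θBal F.L (γ * ((F.L : ℝ)⁻¹) ^ d) b₀ p₀) K 1 ∩
        {U | θBal F.L (γ * ((F.L : ℝ)⁻¹) ^ d) b₀ p₀ 0 ≤ GaugeGroup.dist1 (GaugeField.plaqHol
          (Averaging.iter (fun i => BlockAveraging.blockAvg (P := (F.refine d).P K) (j := i) ℰp) K U) p)} := by
    ext V
    simp only [histGood, Set.mem_setOf_eq, Set.mem_inter_iff]
    exact ⟨fun ⟨h1, h2⟩ => ⟨fun j hj => h1 j (by omega), h2⟩, fun ⟨h1, h2⟩ => ⟨fun k hk => h1 k (by omega), h2⟩⟩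
  have h1 : (gibbsK (F.refine d) ℰp (γ * ((F.L : ℝ)⁻¹) ^ d) K).real
      {V | (∀ k, k < K → PlaqSmall (θBal F.L (γ * ((F.L : ℝ)⁻¹) ^ d) b₀ p₀ (K - k))
          (Averaging.iter (fun i => BlockAveraging.blockAvg (P := (F.refine d).P K) (j := i) ℰp) k V)) ∧
        θBal F.L (γ * ((F.L : ℝ)⁻¹) ^ d) b₀ p₀ 0 ≤ GaugeGroup.dist1 (GaugeField.plaqHol
          (Averaging.iter (fun i => BlockAveraging.blockAvg (P := (F.refine d).P K) (j := i) ℰp) K V) p)} ≤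
      (cond (gibbsK (F.refine d) ℰp (γ * ((F.L : ℝ)⁻¹) ^ d) K)
          (histGood (F.refine d) ℰp (θBal F.L (γ * ((F.L : ℝ)⁻¹) ^ d) b₀ p₀) K 1)).real
        {U | θBal F.L (γ * ((F.L : ℝ)⁻¹) ^ d) b₀ p₀ 0 ≤ GaugeGroup.dist1 (GaugeField.plaqHol
          (Averaging.iter (fun i => BlockAveraging.blockAvg (P := (F.refine d).P K) (j := i) ℰp) K U) p)} := by
    rw [hevent]
    exact real_inter_le_cond_real _ hS _
  -- (2) at `K = 2`: conditional tail ≤ twice the joint mass ≤ twice the crude two-step bound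
  haveI := isProbabilityMeasure_gibbsK (F.refine d) ℰp hγd0 2
  have hS2 : MeasurableSet (histGood (F.refine d) ℰp (θBal F.L (γ * ((F.L : ℝ)⁻¹) ^ d) b₀ p₀) 2 1) :=
    measurableSet_histGood (F.refine d) ℰp measurableE_ℰp _ 2 1
  have h2 : (cond (gibbsK (F.refine d) ℰp (γ * ((F.L : ℝ)⁻¹) ^ d) 2)
        (histGood (F.refine d) ℰp (θBal F.L (γ * ((F.L : ℝ)⁻¹) ^ d) b₀ p₀) 2 1)).real
      {U | θBal F.L (γ * ((F.L : ℝ)⁻¹) ^ d) b₀ p₀ 0 ≤ GaugeGroup.dist1 (GaugeField.plaqHol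
        (Averaging.iter (fun i => BlockAveraging.blockAvg (P := (F.refine d).P 2) (j := i) ℰp) 2 U)
        (plaqShift ((F.refine d).sitesPerDir_unit 2) ((plaqShift ((F.refine d).sitesPerDir_unit K)).symm p)))} ≤
      2 * (C_b * ((γ * ((F.L : ℝ)⁻¹) ^ d)⁻¹) ^ A_b *
        Real.exp (-(c_b * B10.pFun b₀ p₀ (Real.sqrt (γ * ((F.L : ℝ)⁻¹) ^ d)) ^ 2))) := by
    refine (cond_real_le_two_mul _ hS2 (hhalf d hd₃) _).trans ?_
    refine mul_le_mul_of_nonneg_left ?_ (by norm_num)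
    have hev2 : histGood (F.refine d) ℰp (θBal F.L (γ * ((F.L : ℝ)⁻¹) ^ d) b₀ p₀) 2 1 ∩
        {U | θBal F.L (γ * ((F.L : ℝ)⁻¹) ^ d) b₀ p₀ 0 ≤ GaugeGroup.dist1 (GaugeField.plaqHol
          (Averaging.iter (fun i => BlockAveraging.blockAvg (P := (F.refine d).P 2) (j := i) ℰp) 2 U)
          (plaqShift ((F.refine d).sitesPerDir_unit 2) ((plaqShift ((F.refine d).sitesPerDir_unit K)).symm p)))} =
        {V | (∀ k, k < 2 → PlaqSmall (θBal F.L (γ * ((F.L : ℝ)⁻¹) ^ d) b₀ p₀ (2 - k))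
            (Averaging.iter (fun i => BlockAveraging.blockAvg (P := (F.refine d).P 2) (j := i) ℰp) k V)) ∧
          θBal F.L (γ * ((F.L : ℝ)⁻¹) ^ d) b₀ p₀ 0 ≤ GaugeGroup.dist1 (GaugeField.plaqHol
            (Averaging.iter (fun i => BlockAveraging.blockAvg (P := (F.refine d).P 2) (j := i) ℰp) 2 V)
            (plaqShift ((F.refine d).sitesPerDir_unit 2) ((plaqShift ((F.refine d).sitesPerDir_unit K)).symm p)))} := by
      ext V
      simp only [histGood, Set.mem_setOf_eq, Set.mem_inter_iff]
      exact ⟨fun ⟨h1, h2⟩ => ⟨fun k hk => h1 k (by omega), h2⟩, fun ⟨h1, h2⟩ => ⟨fun j hj => h1 j (by omega), h2⟩⟩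
    rw [hev2]
    exact hbase d hd₂ _
  -- (3) assemble: chain, absorb the slack `R d ≤ A + (c_b/2)·p²`
  have hR := (hρ K).trans (hA d hd₁)
  have hP2n : 0 ≤ B10.pFun b₀ p₀ (Real.sqrt (γ * ((F.L : ℝ)⁻¹) ^ d)) ^ 2 := sq_nonneg _
  have hβ0 : 0 ≤ ((γ * ((F.L : ℝ)⁻¹) ^ d)⁻¹) ^ A_b := pow_nonneg (inv_nonneg.mpr hγd0) _
  have hexp : Real.exp (∑ k ∈ Finset.Ico 2 K, ρ k) ≤
      Real.exp (A + c_b / 2 * B10.pFun b₀ p₀ (Real.sqrt (γ * ((F.L : ℝ)⁻¹) ^ d)) ^ 2) := Real.exp_le_exp.mpr hR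
  refine h1.trans (hch.trans ?_)
  refine (mul_le_mul hexp h2 measureReal_nonneg (Real.exp_nonneg _)).trans (le_of_eq ?_)
  have hsplit : Real.exp (A + c_b / 2 * B10.pFun b₀ p₀ (Real.sqrt (γ * ((F.L : ℝ)⁻¹) ^ d)) ^ 2) *
      Real.exp (-(c_b * B10.pFun b₀ p₀ (Real.sqrt (γ * ((F.L : ℝ)⁻¹) ^ d)) ^ 2)) =
      Real.exp A * Real.exp (-(c_b / 2 * B10.pFun b₀ p₀ (Real.sqrt (γ * ((F.L : ℝ)⁻¹) ^ d)) ^ 2)) := by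
    rw [← Real.exp_add, ← Real.exp_add]; ring_nf
  calc Real.exp (A + c_b / 2 * B10.pFun b₀ p₀ (Real.sqrt (γ * ((F.L : ℝ)⁻¹) ^ d)) ^ 2) *
        (2 * (C_b * ((γ * ((F.L : ℝ)⁻¹) ^ d)⁻¹) ^ A_b *
          Real.exp (-(c_b * B10.pFun b₀ p₀ (Real.sqrt (γ * ((F.L : ℝ)⁻¹) ^ d)) ^ 2))))
      = 2 * C_b * ((γ * ((F.L : ℝ)⁻¹) ^ d)⁻¹) ^ A_b *
          (Real.exp (A + c_b / 2 * B10.pFun b₀ p₀ (Real.sqrt (γ * ((F.L : ℝ)⁻¹) ^ d)) ^ 2) *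
            Real.exp (-(c_b * B10.pFun b₀ p₀ (Real.sqrt (γ * ((F.L : ℝ)⁻¹) ^ d)) ^ 2))) := by ring
    _ = 2 * C_b * Real.exp A * ((γ * ((F.L : ℝ)⁻¹) ^ d)⁻¹) ^ A_b *
          Real.exp (-(c_b / 2 * B10.pFun b₀ p₀ (Real.sqrt (γ * ((F.L : ℝ)⁻¹) ^ d)) ^ 2)) := by rw [hsplit]; ring

/-- ★ **CRUX r3 FROM THE ONE-STEP CONDITIONAL UV-STABILITY `CondStabFam`**: if for every block size `L` there is a profile (`0 < b₀`, `2 < p₀`) such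
that every family `F` (`F.L = L`) at every `γ > 0` satisfies `CondStab` (doc above: family by family, on the pure small-field sector, one ultraviolet level
at a time, accumulated slack sub-Gaussian in `p`), then `LargeFieldMassRefinementTail` (stmt-QuantumFields-22884) holds — via `unitTopBody_of_condStab` and
the landed `largeFieldMassRefinementTail_of_unitTopFam`.  Conditional certificate: `CondStab` is NOT proved (it is the small-field half of one
renormalisation step of [Balaban1985UV3]/[Balaban1987RG1], read on one local tail event); nothing about the mass gap.
[cite: Balaban1985UV3, (70)-(71) p.273; Balaban1987RG1, Thm 1 p.259] -/
theorem largeFieldMassRefinementTail_of_condStabFam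
    (hCS : ∀ L : ℕ, ∃ (b₀ p₀ : ℝ), 0 < b₀ ∧ 2 < p₀ ∧ ∀ (F : T3Family) (γ : ℝ), F.L = L → 0 < γ →
      ∃ (n₁ : ℕ) (R : ℕ → ℝ),
        (∀ η : ℝ, 0 < η → ∃ A : ℝ, ∀ d : ℕ, n₁ ≤ d →
          R d ≤ A + η * B10.pFun b₀ p₀ (Real.sqrt (γ * ((F.L : ℝ)⁻¹) ^ d)) ^ 2) ∧
        ∀ d : ℕ, n₁ ≤ d → ∀ q : Plaq ((F.refine d).P 0) 0, ∃ ρ : ℕ → ℝ,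
          (∀ K : ℕ, ∑ k ∈ Finset.Ico 2 K, ρ k ≤ R d) ∧
          ∀ K : ℕ, 2 ≤ K →
            (cond (gibbsK (F.refine d) ℰp (γ * ((F.L : ℝ)⁻¹) ^ d) (K + 1))
                (histGood (F.refine d) ℰp (θBal F.L (γ * ((F.L : ℝ)⁻¹) ^ d) b₀ p₀) (K + 1) 1)).real
              {U | θBal F.L (γ * ((F.L : ℝ)⁻¹) ^ d) b₀ p₀ 0 ≤ GaugeGroup.dist1 (GaugeField.plaqHol
                (Averaging.iter (fun i => BlockAveraging.blockAvg (P := (F.refine d).P (K + 1)) (j := i) ℰp) (K + 1) U)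
                (plaqShift ((F.refine d).sitesPerDir_unit (K + 1)) q))} ≤
            Real.exp (ρ K) *
            (cond (gibbsK (F.refine d) ℰp (γ * ((F.L : ℝ)⁻¹) ^ d) K)
                (histGood (F.refine d) ℰp (θBal F.L (γ * ((F.L : ℝ)⁻¹) ^ d) b₀ p₀) K 1)).real
              {U | θBal F.L (γ * ((F.L : ℝ)⁻¹) ^ d) b₀ p₀ 0 ≤ GaugeGroup.dist1 (GaugeField.plaqHol
                (Averaging.iter (fun i => BlockAveraging.blockAvg (P := (F.refine d).P K) (j := i) ℰp) K U)
                (plaqShift ((F.refine d).sitesPerDir_unit K) q))}) :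
    Summit.QuantumFields.YangMills.Theses.SmallFieldWidening.LargeFieldMassRefinementTail := by
  refine largeFieldMassRefinementTail_of_unitTopFam fun L => ?_
  obtain ⟨b₀, p₀, hb₀, hp₀, h⟩ := hCS L
  refine ⟨b₀, p₀, hb₀, hp₀, fun F γ hFL hγ => ?_⟩
  exact unitTopBody_of_condStab F hγ hb₀ (by linarith) (h F γ hFL hγ)

end Reduction

end Summit.QuantumFields.YangMills.Theorems.LargeFieldMassRefinementTailCondStab

end
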